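import Literature.AlgebraicGeometry.Motives.FaltingsECEndCoreOrdinaryProofs
import Literature.NumberTheory.EllipticCurves.KernelReductionTateFormInertiaProofs
import HarnessLib

/-!
# Faltings 1983, Satz 4 for an elliptic curve: the core fact at a place `v ∣ ℓ` with
# `ord_v(j) < 0` (Serre 1968, IV.2.2 with A.1.2–A.1.3)

Theorem-only sequel of `FaltingsECEndCoreOrdinaryProofs` (the core fact of Satz 4 / Serre IV.2.2
for a curve with an ordinary good place above `ℓ`) and `FaltingsECEndCoreCasesProofs` (the case
`ord_v(j) < 0` at a place `v ∤ ℓ`).  This file proves the core statement — for `E/K` over a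
number field with `V_ℓ E` free of `Γ_K`-stable lines, every `Γ_K`-equivariant endomorphism of
`V_ℓ E` is a scalar — **for a curve with `ord_v(j(E)) < 0` at a place `v ∣ ℓ`** (`ℓ` odd), i.e.
potentially multiplicative reduction above `ℓ`, and hence at **any** finite place with
`ord_v(j) < 0` (`exists_eq_smul_one_of_equivariant_of_one_lt_valuation_j_of_ne_two`).

The local input is `WeierstrassCurve.exists_cyclotomicCharacter_ne_one_card_map_smul_sub_le_of_one_lt_valuation_j`
(`KernelReductionTateFormInertiaProofs`): some `τ ∈ Γ_K` has `χ_ℓ(τ) ≠ 1` and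
`#((τ - 1) E[ℓᵐ]) ≤ ℓᵐ` for all `m` (transport to the Tate form of invariant `j` over `K_v`, on
which the decomposition group moves `ℓ`-power torsion into the kernel of reduction, of height
`1`).  The generic step `exists_eq_smul_one_of_equivariant_of_card_map_smul_sub_le` (the rank
argument of `FaltingsECEndCoreOrdinaryProofs`: `ρ_ℓ(τ) - 1` is non-zero and not surjective, so
`τ` fixes exactly a line, and `exists_eq_smul_one_of_forall_commute_of_fixed_line` applies) then
gives the scalar commutant; the named fact `exists_eq_smul_one_of_equivariant_of_not_hasRationalCM`,
Faltings' Satz 4 (`mem_span_range_tateEndRingHom_iff`), the subspace statement for `E × E`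
(`stable_subspace_prod_eq_range`) and Korollar 1 for `(E, E)` follow for such `(E, ℓ)`
unconditionally.  The `ℓ = 2` ordinary case and the resulting frontier theorems are in the
sequel `FaltingsECEndCoreFrontierProofs`.

## References

* [SerreAbelianLadic1968] J.-P. Serre, *Abelian ℓ-adic representations and elliptic curves*
  (1968), Ch. IV §2.2, A.1.2–A.1.3.
* [Faltings1983Endlichkeit] G. Faltings, Invent. Math. 73 (1983), §5 Satz 4 and Korollar 1.
-/

noncomputable section

open scoped TensorProduct

universe u

namespace Literature.AlgebraicGeometry.Motives

open WeierstrassCurve Module Literature.NumberTheory.EllipticCurves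
  Literature.NumberTheory.GaloisRepresentations Field IsDedekindDomain
open scoped NumberField

variable {K : Type u} [Field K] (W : WeierstrassCurve K) (ℓ : ℕ) [hℓ : Fact ℓ.Prime]

/-- **An element with `χ_ℓ(τ) ≠ 1` and `#((τ - 1) E[ℓᵐ]) ≤ ℓᵐ` for all `m` forces the scalar
commutant.**  For an elliptic curve `E` over a number field `K`, a prime `ℓ` and `τ ∈ Γ_K` with
`χ_ℓ(τ) ≠ 1` such that the image of `E[ℓᵐ]` under `P ↦ P^τ - P` has at most `ℓᵐ` elements for
every `m`: if `V_ℓ E` has no `Γ_K`-stable line, every `Γ_K`-equivariant endomorphism of `V_ℓ E`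
is a scalar.  Indeed `ρ_ℓ(τ) - 1` is non-zero (`det ρ_ℓ(τ) = χ_ℓ(τ)`) and not surjective
(`not_surjective_rationalGaloisRepTate_sub_one`), so `τ` fixes exactly a line of the plane
`V_ℓ E` (`exists_eq_smul_one_of_forall_commute_of_fixed_line`; Serre 1968, IV.2.2: no element of
a non-split Cartan subgroup has the eigenvalue `1` with multiplicity one).
[cite: SerreAbelianLadic1968, IV.2.2] -/
theorem exists_eq_smul_one_of_equivariant_of_card_map_smul_sub_le [NumberField K] [W.IsElliptic]
    {τ : Field.absoluteGaloisGroup K} (hχ : GaloisRep.cyclotomicCharacter K ℓ τ ≠ 1)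
    (hcard : ∀ m : ℕ, Nat.card ((geomTorsion W ((ℓ ^ m : ℕ) : ℤ)).map
      (DistribSMul.toAddMonoidHom (geomPoints W) τ - AddMonoidHom.id (geomPoints W))) ≤ ℓ ^ m)
    (hnl : ∀ L : Submodule ℚ_[ℓ] (W.rationalTateModule ℓ),
      (∀ σ : Field.absoluteGaloisGroup K, ∀ v ∈ L, rationalGaloisRepTate W ℓ σ v ∈ L) →
        Module.finrank ℚ_[ℓ] L ≠ 1)
    (G : Module.End ℚ_[ℓ] (W.rationalTateModule ℓ))
    (hG : ∀ (σ : Field.absoluteGaloisGroup K) (v : W.rationalTateModule ℓ),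
      G (rationalGaloisRepTate W ℓ σ v) = rationalGaloisRepTate W ℓ σ (G v)) :
    ∃ c : ℚ_[ℓ], G = c • 1 := by
  have hℓK : (ℓ : K) ≠ 0 := Nat.cast_ne_zero.mpr hℓ.out.ne_zero
  have h2 := finrank_rationalTateModule_eq_two_holds W ℓ hℓK
  haveI : Module.Finite ℚ_[ℓ] (W.rationalTateModule ℓ) := module_finite_rationalTateModule_holds W ℓ
  set f : Module.End ℚ_[ℓ] (W.rationalTateModule ℓ) := rationalGaloisRepTate W ℓ τ - 1 with hf
  have hns : ¬ Function.Surjective f :=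
    not_surjective_rationalGaloisRepTate_sub_one W ℓ hℓK τ hcard
  have hf0 : f ≠ 0 := fun h0 ↦
    rationalGaloisRepTate_ne_one_of_cyclotomicCharacter_ne_one W ℓ hχ (sub_eq_zero.mp h0)
  have hrange_lt : Module.finrank ℚ_[ℓ] (LinearMap.range f) < 2 := by
    rw [← h2]
    exact Submodule.finrank_lt (mt LinearMap.range_eq_top.mp hns)
  have hrange_pos : 0 < Module.finrank ℚ_[ℓ] (LinearMap.range f) := by
    rw [Module.finrank_pos_iff_exists_ne_zero]
    by_contra hall
    push Not at hall
    apply hf0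
    refine LinearMap.ext fun w ↦ ?_
    have := hall ⟨f w, LinearMap.mem_range_self f w⟩
    rw [Subtype.ext_iff] at this
    exact this
  have hker : Module.finrank ℚ_[ℓ] (LinearMap.ker f) = 1 := by
    have hrn := LinearMap.finrank_range_add_finrank_ker f
    rw [h2] at hrn
    omega
  refine exists_eq_smul_one_of_forall_commute_of_fixed_line h2
    (fun σ ↦ rationalGaloisRepTate W ℓ σ) ({τ} : Set (Field.absoluteGaloisGroup K))
    (L := LinearMap.ker f) (fun w ↦ ?_) hker hnl fun σ ↦ LinearMap.ext fun w ↦ hG σ w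
  simp only [Set.mem_singleton_iff, forall_eq, LinearMap.mem_ker, hf, LinearMap.sub_apply,
    Module.End.one_apply, sub_eq_zero]

/-- **The core of Satz 4 at a place `v ∣ ℓ` with `ord_v(j) < 0`** (`ℓ` odd; potentially
multiplicative reduction above `ℓ`): if `V_ℓ E` has no `Γ_K`-stable line, every
`Γ_K`-equivariant endomorphism of `V_ℓ E` is a scalar (Serre 1968, IV.2.2 with A.1.2–A.1.3:
the `ℓ`-adic image is not in a non-split Cartan subgroup).  No hypothesis on `End_K(E)`.
[cite: SerreAbelianLadic1968, IV.2.2 and A.1.3] -/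
theorem exists_eq_smul_one_of_equivariant_of_one_lt_valuation_j_of_mem [NumberField K]
    [W.IsElliptic] {v : HeightOneSpectrum (𝓞 K)} (hℓv : (ℓ : 𝓞 K) ∈ v.asIdeal) (hℓ2 : ℓ ≠ 2)
    (hj : 1 < v.valuation K W.j)
    (hnl : ∀ L : Submodule ℚ_[ℓ] (W.rationalTateModule ℓ),
      (∀ σ : Field.absoluteGaloisGroup K, ∀ v ∈ L, rationalGaloisRepTate W ℓ σ v ∈ L) →
        Module.finrank ℚ_[ℓ] L ≠ 1)
    (G : Module.End ℚ_[ℓ] (W.rationalTateModule ℓ))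
    (hG : ∀ (σ : Field.absoluteGaloisGroup K) (v : W.rationalTateModule ℓ),
      G (rationalGaloisRepTate W ℓ σ v) = rationalGaloisRepTate W ℓ σ (G v)) :
    ∃ c : ℚ_[ℓ], G = c • 1 := by
  obtain ⟨τ, hχ, hcard⟩ :=
    W.exists_cyclotomicCharacter_ne_one_card_map_smul_sub_le_of_one_lt_valuation_j hℓ2 hℓv hj
  exact exists_eq_smul_one_of_equivariant_of_card_map_smul_sub_le W ℓ hχ hcard hnl G hG

/-- **The core of Satz 4 for a curve with non-integral `j`** (`ℓ` odd): for `E/K` over a number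
field with `ord_v(j(E)) < 0` at some finite place `v` (any residue characteristic), if `V_ℓ E`
has no `Γ_K`-stable line then every `Γ_K`-equivariant endomorphism of `V_ℓ E` is a scalar —
`exists_eq_smul_one_of_equivariant_of_one_lt_valuation_j'` (`v ∤ ℓ`, `FaltingsECEndCoreCasesProofs`)
or the previous theorem (`v ∣ ℓ`).  Serre 1968, IV.2.2 for curves with non-integral `j`.
[cite: SerreAbelianLadic1968, IV.2.2, A.1] -/
theorem exists_eq_smul_one_of_equivariant_of_one_lt_valuation_j_of_ne_two [NumberField K]
    [W.IsElliptic] (hℓ2 : ℓ ≠ 2) {v : HeightOneSpectrum (𝓞 K)} (hj : 1 < v.valuation K W.j)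
    (hnl : ∀ L : Submodule ℚ_[ℓ] (W.rationalTateModule ℓ),
      (∀ σ : Field.absoluteGaloisGroup K, ∀ v ∈ L, rationalGaloisRepTate W ℓ σ v ∈ L) →
        Module.finrank ℚ_[ℓ] L ≠ 1)
    (G : Module.End ℚ_[ℓ] (W.rationalTateModule ℓ))
    (hG : ∀ (σ : Field.absoluteGaloisGroup K) (v : W.rationalTateModule ℓ),
      G (rationalGaloisRepTate W ℓ σ v) = rationalGaloisRepTate W ℓ σ (G v)) :
    ∃ c : ℚ_[ℓ], G = c • 1 := by
  by_cases hℓv : (ℓ : 𝓞 K) ∈ v.asIdeal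
  · exact exists_eq_smul_one_of_equivariant_of_one_lt_valuation_j_of_mem W ℓ hℓv hℓ2 hj hnl G hG
  · exact exists_eq_smul_one_of_equivariant_of_one_lt_valuation_j' W ℓ hℓv hj hnl G hG

/-- **The named core fact for a curve with non-integral `j`** (`ℓ` odd):
`exists_eq_smul_one_of_equivariant_of_not_hasRationalCM W ℓ` holds whenever `ord_v(j(E)) < 0` at
some finite place `v` of `K` — the hypothesis `End_K(E) = ℤ` being superfluous.
[cite: Faltings1983Endlichkeit, §5 Satz 4 (⊗ ℚ_ℓ form; case of non-integral j)]
[cite: SerreAbelianLadic1968, IV.2.2] -/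
theorem exists_eq_smul_one_of_equivariant_of_not_hasRationalCM_of_one_lt_valuation_j_of_ne_two
    (hℓ2 : ℓ ≠ 2) {v : HeightOneSpectrum (𝓞 K)} [NumberField K] [W.IsElliptic]
    (hj : 1 < v.valuation K W.j) :
    exists_eq_smul_one_of_equivariant_of_not_hasRationalCM W ℓ := by
  intro _ _ _ hnl G hG
  exact exists_eq_smul_one_of_equivariant_of_one_lt_valuation_j_of_ne_two W ℓ hℓ2 hj hnl G hG

/-- **Faltings' Satz 4 for an elliptic curve with non-integral `j`** (unconditional; `ℓ` odd):
the named fact `mem_span_range_tateEndRingHom_iff W ℓ` (`End_K(E) ⊗ ℤ_ℓ ≅ End_{Γ_K}(T_ℓ E)`).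
[cite: Faltings1983Endlichkeit, §5 Satz 4 (case of non-integral j)] -/
theorem mem_span_range_tateEndRingHom_iff_of_one_lt_valuation_j_of_ne_two (hℓ2 : ℓ ≠ 2)
    {v : HeightOneSpectrum (𝓞 K)} [NumberField K] [W.IsElliptic] (hj : 1 < v.valuation K W.j) :
    mem_span_range_tateEndRingHom_iff W ℓ := by
  intro _ _
  exact mem_span_range_tateEndRingHom_iff_of_isogenyClass_of_core W ℓ (finite_isogenyClass_holds W)
    (exists_eq_smul_one_of_equivariant_of_not_hasRationalCM_of_one_lt_valuation_j_of_ne_two W ℓ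
      hℓ2 hj)

/-- **Faltings' subspace statement for `E × E`, `E` with non-integral `j`** (unconditional;
`ℓ` odd): the named fact `stable_subspace_prod_eq_range W ℓ` of `FaltingsECSubspaces`.
[cite: Faltings1983Endlichkeit, §5, Sätze 3–4 (case of non-integral j)] -/
theorem stable_subspace_prod_eq_range_of_one_lt_valuation_j_of_ne_two (hℓ2 : ℓ ≠ 2)
    {v : HeightOneSpectrum (𝓞 K)} [NumberField K] [W.IsElliptic] (hj : 1 < v.valuation K W.j) :
    stable_subspace_prod_eq_range W ℓ := by
  intro _ _
  exact stable_subspace_prod_eq_range_of_core W ℓ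
    (exists_eq_smul_one_of_equivariant_of_not_hasRationalCM_of_one_lt_valuation_j_of_ne_two W ℓ
      hℓ2 hj)

/-- **Faltings' Korollar 1 for `(E, E)`, `E` with non-integral `j`** (unconditional; `ℓ` odd):
the named fact `mem_span_range_tateModule_map_of_equivariant W W ℓ`.
[cite: Faltings1983Endlichkeit, §5 Satz 4, Korollar 1 (case of non-integral j)] -/
theorem mem_span_range_tateModule_map_of_equivariant_self_of_one_lt_valuation_j_of_ne_two
    (hℓ2 : ℓ ≠ 2) {v : HeightOneSpectrum (𝓞 K)} [NumberField K] [W.IsElliptic]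
    (hj : 1 < v.valuation K W.j) :
    mem_span_range_tateModule_map_of_equivariant W W ℓ := by
  intro _ _ _
  exact mem_span_range_tateModule_map_of_equivariant_self_of_isogenyClass_of_core W ℓ
    (finite_isogenyClass_holds W)
    (exists_eq_smul_one_of_equivariant_of_not_hasRationalCM_of_one_lt_valuation_j_of_ne_two W ℓ
      hℓ2 hj)

end Literature.AlgebraicGeometry.Motives

end
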